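import Summits.QuantumFields.BalabanUV.Beta.D1BFx.PackedColumnEnvelope
import Summits.QuantumFields.BalabanUV.Beta.D1BFx.RestJetBlockMass

/-!
# `BalabanUV.Beta.D1BFx.PackedColumnJetMass` — road «BF-x» for binder row D1, slot (K), DICT-CHAIN-SPEC §2 (II): **«G0-JET-MASS» — THE CENTRED WEIGHTED
# MASS OF ANY FAMILY SUPERPOSED WITH THE ROAD's M-SIDE PACKED WEIGHTS `colH G₀ n` IS `≤ 4·C_{G₀}·(1 + 16∕κ′)⁴ ×` THE FAMILY's OWN MASS LETTER — POWER `n⁰`**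
# (`G₀ := coDressKBmAt (toSite r) n (KInvStep 3 n 0)`; UNCONDITIONAL): the M-side twin of d1-leaf-04 g19's «RK-JET BLOCK MASSES» (`RestJetBlockMass.mass_blk_vertexOf_le`:
# the UNDRESSED `wH^{(n)}`-pack pays `n⁻⁵ × Zl 4 (κ′∕(8n)) ≤ n⁻¹·(1 + 16∕κ′)⁴`; the GAUGED pack pays `n⁻⁴ × Zl ≤ (1 + 16∕κ′)⁴` by «G0-COL-ENV»)

HONEST DEPENDENCY (cell records, verbatim): «continuum YM on T⁴ ⇐ BetaPertH ∧ nine spine estimates (0/9 proved); BetaPertH ⇐ (D1) ∧ (D4) ∧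
CAP+tail; G-an2-4 gates asym, D1 and NE2/3/4.»  HONEST FRAMING (cell contract, verbatim): «discharging `BetaPertH` makes Bałaban's UV stability
UNCONDITIONAL — a real constructive-QFT result; it is NOT the continuum limit and NOT the Clay problem.»  THIS MODULE DISCHARGES NOTHING of the
wall: [folklore] `ℓ¹` bookkeeping BY NAME over «G0-COL-ENV» (`PackedColumnEnvelope.abs_colH_G₀_road_le`, this lineage) and d1-leaf-04's generic mass lemmas
(`RestJetBlockMass.stencil_mass_recentre` ∕ `mass_sum_wsum_le`, `GhostWordJetLetters.Zl_kappa_le`), an2's `ExpKernelCalculus` lattice constants.  Every mass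
letter of the superposed family is a DISPLAYED hypothesis on an ARBITRARY family; nothing about Bałaban's tables is asserted.  No definition, no
`def … : Prop`, nothing cited, 0 sorry.  NO (1.22) unit row is proved here.  0 root-level binders of row D1 discharged (hW ∕ hR-sockets ∕ hSX-socket ∕
D1Tel ∕ D1Rep = 0); (K) NOT closed; NOT D1, NOT `BetaPertH`, NOT continuum, NOT Clay.

ABSOLUTE RULE (cell charter, verbatim): «No internally-minted statement may enter as a cited fact. Every hypothesis is either kernel-proved in
this package or a verbatim quotation of a PUBLISHED theorem with page reference. The manuscript(s) under audit are NOT citable for their own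
disputed steps — they are the thing under adjudication; programme-internal (2001/route/tribunal) claims are never citable.»

WHY (the OWNER d1-p2 g18's PART 8 `PackedRoadK6cSkeleton` p324577 ✓; d1-leaf-04 g19's CLOSING «OPEN: the n-uniform window bookkeeping of the (II) rows at the
DRESSED packs»; d1-leaf-04 `RestKernelBlockUnit` §3 ∕ `RestBlockWordsLoc`: every RK-BLK ∕ RK-SAND word is leg letters × THE JETS' BLOCK MASSES `mV j k`, displayed).
The road's (K) identity carries its M-side families superposed with ONE weight family `colH G₀ (m+1) μ y κ u`: the jets `vertexOfK G₀ (m+1) (SN m a S)` of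
`legCross ∕ blockTerms`, the comb-FP families `𝒳 κ′ v = Σ_κ wsum (colH G₀ n κ′ v κ) (nFcol r n κ)` of RK-FP, the gauged ghost currents
`𝒢 κ′ v = Σ_κ wsum (colH G₀ n κ′ v κ) (ghCur κ)`.  d1-leaf-04's rows for such jets go through `PackedDressingBridge` (`vertexOfK G₀ n S = vertexOfK (NlegRoad m a) n S^{Π}`)
and then need the block masses of the DRESSED pack `S^{Π} = coProjBmAtK ρ n S`, whose only tree constant is the `(2n+1)⁴`-window `cKb′ ~ n⁵`.  Reading the
dressing on the COLUMN instead («G0-COL-ENV»: `|colH G₀ n μ y κ u| ≤ n⁻⁴·C_{G₀}·e^{−(κ′∕(4n))|u − n•y|₁}`) the same `ℓ¹` bookkeeping as `mass_blk_vertexOf_le` gives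
the mass of ANY `colH G₀`-superposed family from the family's OWN (undressed) letters with the n-FREE constant `4·C_{G₀}·(1 + 16∕κ′)⁴` — one power of `n`
above the undressed N-side jets' `C_V·n⁻¹`, none of the window's `n⁵`.  `n = m + 1`, `κ′ = kappa163 4 ∕ 4`,
`C_{G₀} = (MG163 4·periodConst (kappa163 4) 3)·(1 + 8(1 + e^{κ′}))·e^{κ′}` throughout.

CONTENT.
* §1 [folklore] **`tsum_abs_colH_G₀_mul_exp_le`** — ONE GAUGED WEIGHT AGAINST A SLOW EXPONENTIAL: for `σ ≤ κ′∕(16n)` (any sign), every in-block root, coarse bond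
  `(μ, y)` and fine direction `κ`, `Σ'_u |colH G₀ n μ y κ u|·e^{2σ|u − n•y|₁} ≤ (n⁴)⁻¹·C_{G₀}·Zl 4 (κ′∕(8n))` and the series is summable (the M-side twin of
  d1-leaf-04's `GhostWordJetLetters.tsum_abs_wH_mul_exp_le`); **`tsum_abs_colH_G₀_mul_colH_G₀_le`** — TWO GAUGED WEIGHTS AGAINST EACH OTHER:
  `Σ'_u |colH G₀ n μ y κ u|·|colH G₀ n ν y′ κ u| ≤ W²·e^{−(κ′∕8)|y′ − y|₁}·Zl 4 (κ′∕(8n))`, `W = (n⁴)⁻¹·C_{G₀}` (the tadpole-type tables' letter; twin of their `tsum_abs_wH_mul_wH_le`).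
* §2 [folklore, ANY fibre `F`] **`mass_sum_wsum_colH_G₀_le`** — THE MASS OF A `colH G₀`-SUPERPOSED FAMILY: for `0 ≤ σ ≤ κ′∕(16n)` and a family `T κ u : MKer 4 F`
  with `u`-centred weighted masses `≤ mT` at rate `σ`, the kernel `Σ_κ wsum (colH G₀ n μ y κ) (T κ)` has centred weighted mass at `n•y`, rate `σ`,
  `≤ 4·C_{G₀}·(1 + 16∕κ′)⁴·mT` — this covers the comb-FP family `𝒳` (`T := nFcol r n`, fibre `Unit`), the gauged ghost current `𝒢` (`T := ghCur`) and, blockwise,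
  the packed jets (§3).  The TABLES (tadpole-type `𝒳₂ ∕ 𝒟` and `vertex2OfK G₀ n S₂`) are in the companion `PackedColumnTableMass`.
* §3 [folklore] `blk_vertexOfK` (every block of `vertexOfK K n S μ y` is the `colH K`-superposition of the pack's blocks — definitional);
  **`mass_blk_vertexOfK_G₀_le`** — THE BLOCK MASSES OF THE ROAD's M-SIDE PACKED FIRST JETS: for a first-jet pack `S` (fibre `Fib 3`) with block mass letters
  `mS j k` at rate `σ`, every block of `vertexOfK G₀ n S μ y` has centred weighted mass at `n•y` `≤ 4·C_{G₀}·(1 + 16∕κ′)⁴·mS j k` — the `hVs ∕ hVm` letters of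
  d1-leaf-04's `RestKernelBlockUnit` §3 at the jets `vertexOfK G₀ n (SN m a S)` of PART 8, with `mV j k := 4·C_{G₀}·(1 + 16∕κ′)⁴·mS j k` (power `n⁰`).
NOT HERE (honest): the tables (companion file `PackedColumnTableMass`); the pack's own letters `mS j k(n)` for `SN m a S` ((A2-N) ∕ leaf-03's COFRAME files),
any (1.22) row; whether the gauged column's true power is `n⁻⁵` (then one power better throughout) is not claimed.
Unit `b2b-balaban-gan24-formalise-leaf-05` (gen 53), G-an2-4 swarm leaf prover 05, road «BF-x» supplier; INTENT «G0-JET-MASS» (journal, with «G0-COL-ENV»).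
-/

noncomputable section

open Finset
open scoped BigOperators
open Literature.MathematicalPhysics.QuantumFieldTheory.Balaban1983to89
open Literature.MathematicalPhysics.QuantumFieldTheory.Balaban1983to89.Beta
open B12Sec2to5 (l1 l1_nonneg)
open B5Hk163Strip (kappa163 kappa163_pos)
open B5Hk163Decay (MG163)
open B4TorusKernel (periodConst)
open ExpKernelCalculus (Site MKer Zl Zl_pos Zl_nonneg tsum_exp_shift' summable_exp_shift')
open AffineAveraging (box toSite)
open OneStepResolventKernel (Fib wsum)
open OneStepKernelFamily (colH KInvStep vertexOfK)
open Summit.QuantumFields.BalabanUV.Beta.AxialDressingRooted (coDressKBmAt)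
open Summit.QuantumFields.BalabanUV.Beta.D1BFx.PackedKernelSplit (blk)
open Summit.QuantumFields.BalabanUV.Beta.D1BFx.GhostWordJetLetters (Zl_kappa_le)
open Summit.QuantumFields.BalabanUV.Beta.D1BFx.RestJetBlockMass (stencil_mass_recentre mass_sum_wsum_le)
open Summit.QuantumFields.BalabanUV.Beta.D1BFx.PackedColumnEnvelope (abs_colH_G₀_road_le colH_G₀_road_weight_nonneg)

namespace Summit.QuantumFields.BalabanUV.Beta.D1BFx.PackedColumnJetMass

variable (m : ℕ) {r : Fin (3 + 1) → ℕ} (hr : r ∈ box (3 + 1) (m + 1))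
include hr

/-! ## §1 One gauged weight against a slow exponential -/

/-- [folklore] **ONE GAUGED WEIGHT AGAINST A SLOW EXPONENTIAL**: for `σ ≤ κ′∕(16n)` (any sign),
`Σ'_u |colH G₀ n μ y κ u|·e^{2σ|u − n•y|₁} ≤ (n⁴)⁻¹·C_{G₀}·Zl 4 (κ′∕(8n))` and the series is summable («G0-COL-ENV» leaves the rate `κ′∕(4n) − 2σ ≥ κ′∕(8n)`). -/
theorem tsum_abs_colH_G₀_mul_exp_le {σ : ℝ} (hσ : σ ≤ kappa163 4 / 4 / (16 * ((m + 1 : ℕ) : ℝ))) (μ : Fin (3 + 1)) (y : Fin (3 + 1) → ℤ)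
    (κ : Fin (3 + 1)) :
    (Summable fun u : Fin (3 + 1) → ℤ => |colH (coDressKBmAt (toSite r) (m + 1) (KInvStep (d := 3) (m + 1) 0)) (m + 1) μ y κ u|
        * Real.exp (2 * σ * l1 (u - ((m + 1 : ℕ) : ℤ) • y))) ∧
      ∑' u : Fin (3 + 1) → ℤ, |colH (coDressKBmAt (toSite r) (m + 1) (KInvStep (d := 3) (m + 1) 0)) (m + 1) μ y κ u|
          * Real.exp (2 * σ * l1 (u - ((m + 1 : ℕ) : ℤ) • y))
        ≤ ((((m + 1 : ℕ) : ℝ) ^ 4)⁻¹ * ((MG163 4 * periodConst (kappa163 4) 3)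
            * (1 + 8 * (1 + Real.exp (kappa163 4 / 4))) * Real.exp (kappa163 4 / 4)))
          * Zl 4 (kappa163 4 / 4 / (8 * ((m + 1 : ℕ) : ℝ))) := by
  set C : ℝ := (((m + 1 : ℕ) : ℝ) ^ 4)⁻¹ * ((MG163 4 * periodConst (kappa163 4) 3)
    * (1 + 8 * (1 + Real.exp (kappa163 4 / 4))) * Real.exp (kappa163 4 / 4)) with hC
  have hC0 : 0 ≤ C := colH_G₀_road_weight_nonneg m
  have hn : (0 : ℝ) < ((m + 1 : ℕ) : ℝ) := by exact_mod_cast Nat.succ_pos m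
  have hκ := kappa163_pos 4
  have hr8 : 0 < kappa163 4 / 4 / (8 * ((m + 1 : ℕ) : ℝ)) := by positivity
  set c : Fin (3 + 1) → ℤ := ((m + 1 : ℕ) : ℤ) • y with hc
  -- termwise majorant at the halved rate
  have hterm : ∀ u : Fin (3 + 1) → ℤ, |colH (coDressKBmAt (toSite r) (m + 1) (KInvStep (d := 3) (m + 1) 0)) (m + 1) μ y κ u|
        * Real.exp (2 * σ * l1 (u - c))
      ≤ C * Real.exp (-(kappa163 4 / 4 / (8 * ((m + 1 : ℕ) : ℝ))) * l1 (u - c)) := by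
    intro u
    have h1 := abs_colH_G₀_road_le m hr μ y κ u
    rw [← hc] at h1
    have hl := l1_nonneg (u - c)
    calc |colH (coDressKBmAt (toSite r) (m + 1) (KInvStep (d := 3) (m + 1) 0)) (m + 1) μ y κ u| * Real.exp (2 * σ * l1 (u - c))
        ≤ (C * Real.exp (-(kappa163 4 / 4 / (4 * ((m + 1 : ℕ) : ℝ))) * l1 (u - c))) * Real.exp (2 * σ * l1 (u - c)) :=
          mul_le_mul_of_nonneg_right h1 (Real.exp_pos _).le
      _ = C * Real.exp (-(kappa163 4 / 4 / (4 * ((m + 1 : ℕ) : ℝ))) * l1 (u - c) + 2 * σ * l1 (u - c)) := by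
          rw [Real.exp_add]; ring
      _ ≤ C * Real.exp (-(kappa163 4 / 4 / (8 * ((m + 1 : ℕ) : ℝ))) * l1 (u - c)) := by
          refine mul_le_mul_of_nonneg_left (Real.exp_le_exp.2 ?_) hC0
          have e8 : kappa163 4 / 4 / (4 * ((m + 1 : ℕ) : ℝ)) = 2 * (kappa163 4 / 4 / (8 * ((m + 1 : ℕ) : ℝ))) := by
            field_simp; ring
          have e16 : kappa163 4 / 4 / (16 * ((m + 1 : ℕ) : ℝ)) = (kappa163 4 / 4 / (8 * ((m + 1 : ℕ) : ℝ))) / 2 := by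
            field_simp; ring
          rw [e16] at hσ
          rw [e8]
          nlinarith [hl, hr8]
  have hs := (summable_exp_shift' hr8 c).mul_left C
  have hnn : ∀ u : Fin (3 + 1) → ℤ, 0 ≤ |colH (coDressKBmAt (toSite r) (m + 1) (KInvStep (d := 3) (m + 1) 0)) (m + 1) μ y κ u|
      * Real.exp (2 * σ * l1 (u - c)) := fun u => by positivity
  have hsum := Summable.of_nonneg_of_le hnn hterm hs
  refine ⟨hsum, (hsum.tsum_le_tsum hterm hs).trans (le_of_eq ?_)⟩
  rw [tsum_mul_left, tsum_exp_shift']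

/-- [folklore] **TWO GAUGED WEIGHTS AGAINST EACH OTHER** (the tables' weight; the M-side twin of d1-leaf-04's `GhostWordJetLetters.tsum_abs_wH_mul_wH_le`):
`Σ'_u |colH G₀ n μ y κ u|·|colH G₀ n ν y′ κ u| ≤ W·W·e^{−(κ′∕8)|y′ − y|₁}·Zl 4 (κ′∕(8n))`, `W = (n⁴)⁻¹·C_{G₀}`, and the series is summable (half the rate pays the
`u`-sum, the other half reaches the COARSE separation through `|n•y′ − n•y|₁ = n·|y′ − y|₁`) — the letter of the tadpole-type tables `𝒳₂ ∕ 𝒟` of PART 7∕8. -/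
theorem tsum_abs_colH_G₀_mul_colH_G₀_le (κ μ ν : Fin (3 + 1)) (y y' : Fin (3 + 1) → ℤ) :
    (Summable fun u : Fin (3 + 1) → ℤ =>
      |colH (coDressKBmAt (toSite r) (m + 1) (KInvStep (d := 3) (m + 1) 0)) (m + 1) μ y κ u|
        * |colH (coDressKBmAt (toSite r) (m + 1) (KInvStep (d := 3) (m + 1) 0)) (m + 1) ν y' κ u|) ∧
      ∑' u : Fin (3 + 1) → ℤ, |colH (coDressKBmAt (toSite r) (m + 1) (KInvStep (d := 3) (m + 1) 0)) (m + 1) μ y κ u|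
          * |colH (coDressKBmAt (toSite r) (m + 1) (KInvStep (d := 3) (m + 1) 0)) (m + 1) ν y' κ u|
        ≤ ((((m + 1 : ℕ) : ℝ) ^ 4)⁻¹ * ((MG163 4 * periodConst (kappa163 4) 3)
              * (1 + 8 * (1 + Real.exp (kappa163 4 / 4))) * Real.exp (kappa163 4 / 4)))
          * ((((m + 1 : ℕ) : ℝ) ^ 4)⁻¹ * ((MG163 4 * periodConst (kappa163 4) 3)
              * (1 + 8 * (1 + Real.exp (kappa163 4 / 4))) * Real.exp (kappa163 4 / 4)))
          * Real.exp (-(kappa163 4 / 4 / 8) * l1 (y' - y)) * Zl 4 (kappa163 4 / 4 / (8 * ((m + 1 : ℕ) : ℝ))) := by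
  set C : ℝ := (((m + 1 : ℕ) : ℝ) ^ 4)⁻¹ * ((MG163 4 * periodConst (kappa163 4) 3)
    * (1 + 8 * (1 + Real.exp (kappa163 4 / 4))) * Real.exp (kappa163 4 / 4)) with hC
  have hC0 : 0 ≤ C := colH_G₀_road_weight_nonneg m
  have hn : (0 : ℝ) < ((m + 1 : ℕ) : ℝ) := by exact_mod_cast Nat.succ_pos m
  have hκ := kappa163_pos 4
  set ρ : ℝ := kappa163 4 / 4 / (8 * ((m + 1 : ℕ) : ℝ)) with hρ
  have hρ0 : 0 < ρ := by positivity
  set c : Fin (3 + 1) → ℤ := ((m + 1 : ℕ) : ℤ) • y with hc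
  set c' : Fin (3 + 1) → ℤ := ((m + 1 : ℕ) : ℤ) • y' with hc'
  -- the coarse exponential: `ρ·|c′ − c|₁ = (κ′∕8)·|y′ − y|₁`
  have hcc : ρ * l1 (c' - c) = kappa163 4 / 4 / 8 * l1 (y' - y) := by
    rw [hc, hc', ← smul_sub, ExpKernelCalculus.l1_natSmul, hρ]
    field_simp
  -- termwise majorant
  have hterm : ∀ u : Fin (3 + 1) → ℤ,
      |colH (coDressKBmAt (toSite r) (m + 1) (KInvStep (d := 3) (m + 1) 0)) (m + 1) μ y κ u|
        * |colH (coDressKBmAt (toSite r) (m + 1) (KInvStep (d := 3) (m + 1) 0)) (m + 1) ν y' κ u|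
      ≤ C * C * Real.exp (-(kappa163 4 / 4 / 8) * l1 (y' - y)) * Real.exp (-ρ * l1 (u - c)) := by
    intro u
    have h1 := abs_colH_G₀_road_le m hr μ y κ u
    have h2 := abs_colH_G₀_road_le m hr ν y' κ u
    rw [← hc] at h1
    rw [← hc'] at h2
    have e4 : kappa163 4 / 4 / (4 * ((m + 1 : ℕ) : ℝ)) = 2 * ρ := by rw [hρ]; field_simp; ring
    rw [e4] at h1 h2
    have t : l1 (c' - c) ≤ l1 (c' - u) + l1 (u - c) := ExpKernelCalculus.l1_sub_triangle c' u c
    rw [ExpKernelCalculus.l1_sub_symm c' u] at t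
    have hu := l1_nonneg (u - c)
    have hu' := l1_nonneg (u - c')
    calc |colH (coDressKBmAt (toSite r) (m + 1) (KInvStep (d := 3) (m + 1) 0)) (m + 1) μ y κ u|
          * |colH (coDressKBmAt (toSite r) (m + 1) (KInvStep (d := 3) (m + 1) 0)) (m + 1) ν y' κ u|
        ≤ (C * Real.exp (-(2 * ρ) * l1 (u - c))) * (C * Real.exp (-(2 * ρ) * l1 (u - c'))) :=
          mul_le_mul h1 h2 (abs_nonneg _) ((abs_nonneg _).trans h1)
      _ = C * C * Real.exp (-(2 * ρ) * l1 (u - c) + -(2 * ρ) * l1 (u - c')) := by rw [Real.exp_add]; ring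
      _ ≤ C * C * Real.exp (-ρ * l1 (c' - c) + -ρ * l1 (u - c)) := by
          refine mul_le_mul_of_nonneg_left (Real.exp_le_exp.2 ?_) (mul_nonneg hC0 hC0)
          nlinarith [mul_nonneg hρ0.le hu, mul_nonneg hρ0.le hu', mul_nonneg hρ0.le (show 0 ≤ l1 (u - c') + l1 (u - c) - l1 (c' - c) by linarith)]
      _ = C * C * Real.exp (-(kappa163 4 / 4 / 8) * l1 (y' - y)) * Real.exp (-ρ * l1 (u - c)) := by
          rw [Real.exp_add, show -ρ * l1 (c' - c) = -(ρ * l1 (c' - c)) by ring, hcc]; ring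
  have hs := (summable_exp_shift' hρ0 c).mul_left (C * C * Real.exp (-(kappa163 4 / 4 / 8) * l1 (y' - y)))
  have hnn : ∀ u : Fin (3 + 1) → ℤ, 0 ≤ |colH (coDressKBmAt (toSite r) (m + 1) (KInvStep (d := 3) (m + 1) 0)) (m + 1) μ y κ u|
      * |colH (coDressKBmAt (toSite r) (m + 1) (KInvStep (d := 3) (m + 1) 0)) (m + 1) ν y' κ u| := fun u => by positivity
  have hsum := Summable.of_nonneg_of_le hnn hterm hs
  refine ⟨hsum, (hsum.tsum_le_tsum hterm hs).trans (le_of_eq ?_)⟩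
  rw [tsum_mul_left, tsum_exp_shift']

/-! ## §2 The mass of a `colH G₀`-superposed family (any fibre) -/

/-- [folklore] **«G0-JET-MASS», SUPERPOSITION FORM** (ANY fibre `F`): for `0 ≤ σ ≤ κ′∕(16n)` and a family `T κ u : MKer 4 F` whose every member has `u`-centred
weighted mass `Σ'_{(p,q)} Σ_{ab} |T κ u p q a b|·e^{σ(|p − u|₁ + |q − u|₁)} ≤ mT`, the `colH G₀`-superposition `Σ_κ wsum (colH G₀ n μ y κ) (T κ)` has centred weighted mass
at `n•y`, rate `σ`, summable and `≤ 4·C_{G₀}·(1 + 16∕κ′)⁴ · mT` — per direction `Σ'_u |colH G₀ n μ y κ u|·mT·e^{2σ|u − n•y|₁} ≤ mT·(n⁴)⁻¹·C_{G₀}·Zl 4 (κ′∕(8n))`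
(§1), four directions, `(n⁴)⁻¹·Zl ≤ (1 + 16∕κ′)⁴` (`Zl_kappa_le`).  POWER `n⁰`. -/
theorem mass_sum_wsum_colH_G₀_le {F : Type*} [Fintype F] {T : Fin (3 + 1) → (Fin (3 + 1) → ℤ) → MKer 4 F} {σ mT : ℝ} (hσ0 : 0 ≤ σ)
    (hσ : σ ≤ kappa163 4 / 4 / (16 * ((m + 1 : ℕ) : ℝ)))
    (hTs : ∀ κ u, Summable fun p : Site 4 × Site 4 => ∑ a, ∑ b, |T κ u p.1 p.2 a b| * Real.exp (σ * (l1 (p.1 - u) + l1 (p.2 - u))))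
    (hTm : ∀ κ u, ∑' p : Site 4 × Site 4, ∑ a, ∑ b, |T κ u p.1 p.2 a b| * Real.exp (σ * (l1 (p.1 - u) + l1 (p.2 - u))) ≤ mT)
    (μ : Fin (3 + 1)) (y : Fin (3 + 1) → ℤ) :
    (Summable fun p : Site 4 × Site 4 => ∑ a, ∑ b,
        |(∑ κ : Fin (3 + 1), wsum (colH (coDressKBmAt (toSite r) (m + 1) (KInvStep (d := 3) (m + 1) 0)) (m + 1) μ y κ) (T κ)) p.1 p.2 a b|
          * Real.exp (σ * (l1 (p.1 - ((m + 1 : ℕ) : ℤ) • y) + l1 (p.2 - ((m + 1 : ℕ) : ℤ) • y)))) ∧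
      ∑' p : Site 4 × Site 4, ∑ a, ∑ b,
          |(∑ κ : Fin (3 + 1), wsum (colH (coDressKBmAt (toSite r) (m + 1) (KInvStep (d := 3) (m + 1) 0)) (m + 1) μ y κ) (T κ)) p.1 p.2 a b|
            * Real.exp (σ * (l1 (p.1 - ((m + 1 : ℕ) : ℤ) • y) + l1 (p.2 - ((m + 1 : ℕ) : ℤ) • y)))
        ≤ 4 * ((MG163 4 * periodConst (kappa163 4) 3) * (1 + 8 * (1 + Real.exp (kappa163 4 / 4))) * Real.exp (kappa163 4 / 4))
            * (1 + 16 / (kappa163 4 / 4)) ^ 4 * mT := by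
  have hn0 : (0 : ℝ) < ((m + 1 : ℕ) : ℝ) := by exact_mod_cast Nat.succ_pos m
  set K₀ : ℝ := (MG163 4 * periodConst (kappa163 4) 3) * (1 + 8 * (1 + Real.exp (kappa163 4 / 4))) * Real.exp (kappa163 4 / 4) with hK₀
  set C : ℝ := (((m + 1 : ℕ) : ℝ) ^ 4)⁻¹ * K₀ with hC
  set Z : ℝ := Zl 4 (kappa163 4 / 4 / (8 * ((m + 1 : ℕ) : ℝ))) with hZ
  have hC0 : 0 ≤ C := colH_G₀_road_weight_nonneg m
  have hZ0 : 0 ≤ Z := Zl_nonneg (by have := kappa163_pos 4; positivity)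
  set c : Site 4 := ((m + 1 : ℕ) : ℤ) • y with hc
  set W : Site 4 × Site 4 → ℝ := fun p => Real.exp (σ * (l1 (p.1 - c) + l1 (p.2 - c))) with hW
  have hWpos : ∀ p, 0 < W p := fun p => Real.exp_pos _
  have hmT : 0 ≤ mT :=
    (tsum_nonneg fun p => Finset.sum_nonneg fun a _ => Finset.sum_nonneg fun b _ => by positivity).trans (hTm 0 0)
  -- per stencil: recentred letter `ρ u = mT·e^{2σ|u − c|₁}`
  have hrec : ∀ κ u, (Summable fun p : Site 4 × Site 4 => ∑ a, ∑ b, |T κ u p.1 p.2 a b| * W p) ∧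
      ∑' p : Site 4 × Site 4, ∑ a, ∑ b, |T κ u p.1 p.2 a b| * W p ≤ mT * Real.exp (2 * σ * l1 (u - c)) :=
    fun κ u => stencil_mass_recentre hσ0 u c (hTs κ u) (hTm κ u)
  -- per direction: the weight letter `Σ'_u |colH G₀|·ρ u ≤ mT·C·Z`
  have hw : ∀ κ : Fin (3 + 1),
      (Summable fun u : Site 4 => |colH (coDressKBmAt (toSite r) (m + 1) (KInvStep (d := 3) (m + 1) 0)) (m + 1) μ y κ u|
        * (mT * Real.exp (2 * σ * l1 (u - c)))) ∧
      ∑' u : Site 4, |colH (coDressKBmAt (toSite r) (m + 1) (KInvStep (d := 3) (m + 1) 0)) (m + 1) μ y κ u|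
        * (mT * Real.exp (2 * σ * l1 (u - c))) ≤ mT * (C * Z) := by
    intro κ
    obtain ⟨hs, hb⟩ := tsum_abs_colH_G₀_mul_exp_le m hr hσ μ y κ
    rw [← hc] at hs hb
    have e : (fun u : Site 4 => |colH (coDressKBmAt (toSite r) (m + 1) (KInvStep (d := 3) (m + 1) 0)) (m + 1) μ y κ u|
          * (mT * Real.exp (2 * σ * l1 (u - c))))
        = fun u => mT * (|colH (coDressKBmAt (toSite r) (m + 1) (KInvStep (d := 3) (m + 1) 0)) (m + 1) μ y κ u|
          * Real.exp (2 * σ * l1 (u - c))) := funext fun u => by ring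
    rw [e]
    refine ⟨hs.mul_left mT, ?_⟩
    rw [tsum_mul_left]
    exact mul_le_mul_of_nonneg_left hb hmT
  have hsum := mass_sum_wsum_le (Finset.univ : Finset (Fin (3 + 1)))
    (w := fun κ u => colH (coDressKBmAt (toSite r) (m + 1) (KInvStep (d := 3) (m + 1) 0)) (m + 1) μ y κ u)
    (K := fun κ u => T κ u) (M := fun _ => mT * (C * Z)) hWpos (fun κ u => (hrec κ u).1) (fun κ u => (hrec κ u).2)
    (fun κ => (hw κ).1) (fun κ => (hw κ).2)
  refine ⟨hsum.1, hsum.2.trans ?_⟩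
  rw [Finset.sum_const, Finset.card_univ, Fintype.card_fin, nsmul_eq_mul]
  -- the count: `4·mT·C·Z = 4·K₀·((n⁴)⁻¹·Z)·mT ≤ 4·K₀·(1 + 16∕κ′)⁴·mT`
  have hK0 : 0 ≤ K₀ := by
    have hn4 : 0 < ((((m + 1 : ℕ) : ℝ)) ^ 4)⁻¹ := by positivity
    exact (mul_nonneg_iff_of_pos_left hn4).1 hC0
  have hZl : (((m + 1 : ℕ) : ℝ) ^ 4)⁻¹ * Z ≤ (1 + 16 / (kappa163 4 / 4)) ^ 4 := by
    have h := Zl_kappa_le m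
    have e : kappa163 (3 + 1) / (3 + 1) = kappa163 4 / 4 := by norm_num
    rw [e] at h
    exact h
  have e1 : (((3 + 1 : ℕ) : ℕ) : ℝ) * (mT * (C * Z)) = 4 * K₀ * ((((m + 1 : ℕ) : ℝ) ^ 4)⁻¹ * Z) * mT := by
    rw [hC]; push_cast; ring
  rw [e1]
  have h4 : 0 ≤ 4 * K₀ := by positivity
  calc 4 * K₀ * ((((m + 1 : ℕ) : ℝ) ^ 4)⁻¹ * Z) * mT
      ≤ 4 * K₀ * (1 + 16 / (kappa163 4 / 4)) ^ 4 * mT :=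
        mul_le_mul_of_nonneg_right (mul_le_mul_of_nonneg_left hZl h4) hmT
    _ = _ := by ring

/-! ## §3 The block masses of the road's M-side packed first jets `vertexOfK G₀ n S μ y` -/

omit hr in
/-- [our object] **EVERY BLOCK OF A PACKED CHAIN-RULE VERTEX IS THE `colH`-SUPERPOSITION OF THE PACK's BLOCKS** (definitional; the `vertexOfK` form of
d1-leaf-04's `RestJetBlockMass.blk_vertexOf`). -/
theorem blk_vertexOfK (K : MKer 4 (Fib 3)) (n : ℕ) (S : Fin (3 + 1) → (Fin (3 + 1) → ℤ) → MKer 4 (Fib 3)) (μ : Fin (3 + 1))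
    (y : Fin (3 + 1) → ℤ) (j k : Bool) :
    blk (vertexOfK K n S μ y) j k = ∑ κ : Fin (3 + 1), wsum (colH K n μ y κ) (fun u => blk (S κ u) j k) := by
  funext x z a b
  simp only [PackedKernelSplit.blk, OneStepKernelFamily.vertexOfK, Finset.sum_apply, OneStepResolventKernel.wsum]

/-- [folklore] **«G0-JET-MASS»: THE BLOCK MASSES OF THE ROAD's M-SIDE PACKED FIRST JETS** (UNCONDITIONAL): for `0 ≤ σ ≤ κ′∕(16n)` and a PACKED first-jet pack
`S` (fibre `Fib 3`) with block mass letters `Σ'|blk (S κ u) j k|·e^{σ(|p − u|₁ + |q − u|₁)} ≤ mS j k`, every block of `vertexOfK G₀ n S μ y` has centred weighted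
mass at `n•y`, rate `σ`, `≤ 4·C_{G₀}·(1 + 16∕κ′)⁴ · mS j k` — the `hVs ∕ hVm` letters of `RestKernelBlockUnit` §3 at the jets of PART 8 with
`mV j k := 4·C_{G₀}·(1 + 16∕κ′)⁴·mS j k` (POWER `n⁰`; the undressed N-side jets have `C_V·n⁻¹·mS j k`, `mass_blk_vertexOfK_NlegRoad_le`). -/
theorem mass_blk_vertexOfK_G₀_le {S : Fin (3 + 1) → (Fin (3 + 1) → ℤ) → MKer 4 (Fib 3)} {σ : ℝ} {mS : Bool → Bool → ℝ} (hσ0 : 0 ≤ σ)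
    (hσ : σ ≤ kappa163 4 / 4 / (16 * ((m + 1 : ℕ) : ℝ)))
    (hSs : ∀ κ u j k, Summable fun p : Site 4 × Site 4 =>
      ∑ g, ∑ f, |blk (S κ u) j k p.1 p.2 g f| * Real.exp (σ * (l1 (p.1 - u) + l1 (p.2 - u))))
    (hSm : ∀ κ u j k, ∑' p : Site 4 × Site 4,
      ∑ g, ∑ f, |blk (S κ u) j k p.1 p.2 g f| * Real.exp (σ * (l1 (p.1 - u) + l1 (p.2 - u))) ≤ mS j k)
    (μ : Fin (3 + 1)) (y : Fin (3 + 1) → ℤ) (j k : Bool) :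
    (Summable fun p : Site 4 × Site 4 => ∑ g, ∑ f,
        |blk (vertexOfK (coDressKBmAt (toSite r) (m + 1) (KInvStep (d := 3) (m + 1) 0)) (m + 1) S μ y) j k p.1 p.2 g f|
          * Real.exp (σ * (l1 (p.1 - ((m + 1 : ℕ) : ℤ) • y) + l1 (p.2 - ((m + 1 : ℕ) : ℤ) • y)))) ∧
      ∑' p : Site 4 × Site 4, ∑ g, ∑ f,
          |blk (vertexOfK (coDressKBmAt (toSite r) (m + 1) (KInvStep (d := 3) (m + 1) 0)) (m + 1) S μ y) j k p.1 p.2 g f|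
            * Real.exp (σ * (l1 (p.1 - ((m + 1 : ℕ) : ℤ) • y) + l1 (p.2 - ((m + 1 : ℕ) : ℤ) • y)))
        ≤ 4 * ((MG163 4 * periodConst (kappa163 4) 3) * (1 + 8 * (1 + Real.exp (kappa163 4 / 4))) * Real.exp (kappa163 4 / 4))
            * (1 + 16 / (kappa163 4 / 4)) ^ 4 * mS j k := by
  rw [blk_vertexOfK]
  exact mass_sum_wsum_colH_G₀_le m hr (T := fun κ u => blk (S κ u) j k) hσ0 hσ (fun κ u => hSs κ u j k) (fun κ u => hSm κ u j k) μ y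


end Summit.QuantumFields.BalabanUV.Beta.D1BFx.PackedColumnJetMass

end
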